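import Summits.HodgeConjecture.HodgeConjecture.Theorems.P2StubCFOfLocal
import Literature.NumberTheory.Automorphic.UnitaryGroupLocalTypeSpherical
import HarnessLib

/-!
# CLOSER of stub CF `stub_CF_flathRigidity : StubCFFlathRigidity` of line `Cruxes/H413/Lines/F0_P2CohFinComponentIsThetaC.lean`
# (crux item stmt-HodgeConjecture-24833 `HCCMUnconditional.H413`, programme P2, cell hodgecm-mathlib FLOOR 0): FLATH RIGIDITY

`stubCF_holds` = the REGISTERED body of `StubCFFlathRigidity` (tree f4344dca :161–168) VERBATIM with the Lines-local predicate
`IsLocalTypeAt F E c N J ρ v τ := τ.IsIrreducible ∧ isotypicComponent ℂ[U(J)(F_v)] (ρ ∘ inclPlace v).asModule τ.asModule = ⊤`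
UNFOLDED (the Lines module is not importable, director s380 (b)); the registrar folds `stub_CF_flathRigidity := stubCF_holds` BY NAME.

STATEMENT (Flath 1979, Thm. 3, uniqueness half — for EVERY hermitian datum `J`, no Gelfand-pair∕Satake input): irreducible
ADMISSIBLE `σ`, `ω` of `U(J)(𝔸_{F,f})` with a common irreducible local type at every finite place of `F` admit an injective
intertwiner `σ → ω`.  PROOF = ★ `P2StubCFOfLocal.stubCF_of_local` (transport along ★ `finAdelicEquiv`; boxes; the `K^S`-fixed vectors
are irreducible for the `S`-places and an `S`-equivariant map lifts, ★ `RestrictedProductFixedVectorLift`; local Hecke scalars ★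
`IsotypicHeckeScalar` ∕ ★ `RestrictedProductBoxHeckeScalar`; finite-family rigidity ★ `IsotypicFamilyRigidity` over the peel ★
`IsotypicFamilyPeel` and the isotypic calculus ★ `IsotypicEvaluation`) fed with the two local inputs of F0P2-p04 (g2) ★
`UnitaryGroupLocalTypeSpherical`: the local types of an admissible irreducible `ω` are ADMISSIBLE (`localType_isAdmissible`, hence
scalar commutant) and SPHERICAL at almost every place (`isSpherical_localType_cofinite'`, the dimension count ★
`LocalTypeSphericalAlmostAll` ∕ ★ `prod_finrank_invariants_le`).  Road of record: A-p08 (g16) census 2026-08-31T00:48:28Z, F0P2-plan (g3)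
ruling 00:52:36Z (C); hands F0P2-p04 (g2) (file 4), A-p02 (g18) (★ `FiniteFamilyIsotypicRigidity`, parallel twin of file 5).
HC_CM is proved only modulo the 7 printed citations until rung 0 closes; this file discharges none of them (CF is an in-house
generic lemma, not a printed citation).
-/

set_option autoImplicit false
-- the mandated namespace has the single-problem summit's repeated segment (`HodgeConjecture.HodgeConjecture`)
set_option linter.dupNamespace false

noncomputable section

open NumberField IsDedekindDomain Filter

namespace Summit.HodgeConjecture.HodgeConjecture.Cruxes.H413.P2StubCFFlathRigidity

open Literature.NumberTheory.Automorphic Literature.NumberTheory.Automorphic.UnitaryGroup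

/-- **Stub CF — Flath rigidity for `U(J)(𝔸_{F,f})`** (the registered `StubCFFlathRigidity` with `IsLocalTypeAt` unfolded): irreducible
admissible `σ`, `ω` with a common irreducible local type at every finite place admit an injective intertwiner `σ → ω`.
(print: Flath1979 Thm 3; Bump 1997 Thm 3.4.4, Prop 4.2.3; BorelJacquet1979 §4.3; Getz–Hahn 2024 Thm 5.7.1) -/
theorem stubCF_holds :
    ∀ (F E : Type) [Field F] [NumberField F] [Field E] [NumberField E] [Algebra F E] (c : E ≃ₐ[F] E) (N : ℕ)
      (J : Matrix (Fin N) (Fin N) E) (W W' : Type) [AddCommGroup W] [Module ℂ W] [AddCommGroup W'] [Module ℂ W']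
      (σ : Representation ℂ (finAdelic F E c N J) W) (ω : Representation ℂ (finAdelic F E c N J) W'),
      σ.IsIrreducible → σ.IsAdmissible → ω.IsIrreducible → ω.IsAdmissible →
        (∀ v : HeightOneSpectrum (𝓞 F), ∃ (T : Type) (_ : AddCommGroup T) (_ : Module ℂ T)
          (τ : Representation ℂ (localPi E c N J v) T),
          (τ.IsIrreducible ∧
            isotypicComponent (MonoidAlgebra ℂ (localPi E c N J v)) (Representation.asModule (σ.comp (inclPlace F E c N J v)))
              (Representation.asModule τ) = ⊤) ∧
          (τ.IsIrreducible ∧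
            isotypicComponent (MonoidAlgebra ℂ (localPi E c N J v)) (Representation.asModule (ω.comp (inclPlace F E c N J v)))
              (Representation.asModule τ) = ⊤)) →
        ∃ f : σ.IntertwiningMap ω, Function.Injective f := by
  intro F E _ _ _ _ _ c N J W W' _ _ _ _ σ ω hσirr hσadm hωirr hωadm hloc
  classical
  choose T instAdd instMod τ hτσ hτω using hloc
  haveI := hωirr
  haveI : Nontrivial W' := Representation.IsIrreducible.nontrivial ω
  exact P2StubCFOfLocal.stubCF_of_local F E c N J W W' σ ω hσirr hσadm.isSmooth hωirr hωadm.isSmooth τ (fun v => (hτσ v).1)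
    (fun v => (hτσ v).2) (fun v => (hτω v).2)
    (fun v => Literature.NumberTheory.Automorphic.UnitaryGroup.localType_isAdmissible F E c N J ω hωirr hωadm v (τ v) (hτω v).1
      (hτω v).2)
    (Literature.NumberTheory.Automorphic.UnitaryGroup.isSpherical_localType_cofinite' F E c N J ω hωadm τ (fun v => (hτω v).1)
      fun v => (hτω v).2)

end Summit.HodgeConjecture.HodgeConjecture.Cruxes.H413.P2StubCFFlathRigidity

end
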